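import Literature.Analysis.ODE.SchrodingerSturm
import Literature.Analysis.Calculus.SmoothCutoff
import HarnessLib

/-!
# Truncated Dirichlet-type problems for `-u'' + W u = E u` on large intervals

Topic `Literature/Analysis/ODE` (namespace `Literature.Analysis.ODE`), continuing
`SchrodingerSturm.lean`. For a bounded continuous potential `W` on `ℝ` and a spectral parameter
`E` write the equation as `u'' = (W - E) u`. On a compact interval `[a, b]` consider the shooting
solution `v_E` with `v_E(a) = 1`, `v_E'(a) = 1`. Everything is proved:

* `IsSchrodingerSol.dist_phase_le_param` — continuous dependence on `E` and the data, specialised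
  from `IsSchrodingerSol.dist_phase_le_exp` to coefficients `W - E₁`, `W - E₂`.
* `exists_shooting_eigenpair` — **the lowest "eigenvalue" of the truncated problem by shooting**
  (Hartman, Ch. XI §6, Cor. 6.1 and Thm. 6.2: on a compact interval the equation is disconjugate
  iff it has a positive solution iff the quadratic form is positive definite): if some `C¹`
  function `φ` with `φ a = φ b = 0` has `∫_a^b (φ'² + (W - E') φ²) < 0`, then there is
  `E ∈ [-B - 1, E']` (`|W| ≤ B`) such that `v_E > 0` on `[a, b)` and `v_E(b) = 0`. Proof: the set
  of `E ≤ E'` for which `v_E` has a nonpositive value on `[a, b]` contains `E'` (Picone), is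
  bounded below by `-B - 1` (positivity propagation) and closed (continuous dependence); at its
  infimum `E` the solution is a pointwise limit of positive solutions, hence `≥ 0`, and its zero can
  only sit at `b` (an interior zero of a nonnegative solution is a double zero).
* `exists_shooting_eigenpair_of_rayleigh` — combined with the truncation lemma
  `Literature.Analysis.Calculus.exists_truncForm_integral_neg`: if `ψ ∈ C¹` with `ψ, ψ' ∈ L²(ℝ)` has
  `∫ (ψ'² + W ψ²) < E' ∫ ψ²`, then for every large `R` the interval `[-R, R]` carries such a pair
  `(E_R, v_R)` with `E_R ∈ [-B - 1, E']`.

## References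

* P. Hartman, *Ordinary Differential Equations*, Classics in Applied Mathematics 38 (SIAM 2002),
  Ch. XI §6, Thm. 6.1, Cor. 6.1, Thm. 6.2; Ch. V Thm. 2.1. Key `Hartman2002`.
-/

noncomputable section

open Set Metric Filter MeasureTheory intervalIntegral
open scoped NNReal Topology

namespace Literature.Analysis.ODE

open Literature.Analysis.Calculus

/-! ## Continuous dependence on the spectral parameter -/

/-- **Continuous dependence on `E` and on the data** for `u'' = (W - E₁) u`, `v'' = (W - E₂) v` on
`[a, b] ∋ s₀` with `|W| ≤ B` and `|v| ≤ P` on `[a, b]`: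
`dist (u t, u' t) (v t, v' t) ≤ (dist of the data at s₀ + |E₁ - E₂| P) e^{(|B| + |E₁| + 1)|t - s₀|}`.
[cite: Hartman2002, Ch. V Thm. 2.1] -/
theorem IsSchrodingerSol.dist_phase_le_param {W u v : ℝ → ℝ} {E₁ E₂ B P a b s₀ : ℝ}
    (hu : IsSchrodingerSol (fun s => W s - E₁) u) (hv : IsSchrodingerSol (fun s => W s - E₂) v)
    (hs₀ : s₀ ∈ Icc a b) (hB : ∀ s ∈ Icc a b, |W s| ≤ B) (hP : ∀ s ∈ Icc a b, |v s| ≤ P)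
    (hP0 : 0 ≤ P) :
    ∀ t ∈ Icc a b, dist (u t, deriv u t) (v t, deriv v t) ≤
      (dist (u s₀, deriv u s₀) (v s₀, deriv v s₀) + |E₁ - E₂| * P) *
        Real.exp ((|B| + |E₁| + 1) * |t - s₀|) := by
  have hK1 : (1 : ℝ) ≤ |B| + |E₁| + 1 := by linarith [abs_nonneg B, abs_nonneg E₁]
  exact hu.dist_phase_le_exp hv hs₀ (K := |B| + |E₁| + 1) (η := |E₁ - E₂|) (P := P)
    (fun t ht => by
      calc |W t - E₁| ≤ |W t| + |E₁| := abs_sub _ _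
        _ ≤ |B| + |E₁| + 1 := by linarith [hB t ht, le_abs_self B])
    hK1 (fun t _ => by rw [show W t - E₁ - (W t - E₂) = -(E₁ - E₂) by ring, abs_neg]) hP
    (abs_nonneg _) hP0

/-! ## The lowest eigenvalue of the truncated problem, by shooting -/

/-- **Shooting eigenpair on a compact interval.** Let `W` be continuous with `|W| ≤ B`, `a < b`,
and suppose some `C¹` function `φ` with `φ a = φ b = 0` has `∫_a^b (φ'² + (W - E') φ²) < 0`. Then
there are `E ∈ [-B - 1, E']` and a solution `v` of `v'' = (W - E) v` with `v a = 1`, `v' a = 1`,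
`v > 0` on `[a, b)` and `v b = 0` (Hartman Ch. XI, Cor. 6.1 with Thm. 6.2: below the infimum of
such `E` the equation is disconjugate on `[a, b]`, at it the positive solution acquires a zero at
`b`). [cite: Hartman2002, Ch. XI Thm. 6.2] -/
theorem exists_shooting_eigenpair {W : ℝ → ℝ} (hW : Continuous W) {B : ℝ} (hB : ∀ s, |W s| ≤ B)
    {a b E' : ℝ} (hab : a < b) {φ φ' : ℝ → ℝ} (hφ : ∀ s ∈ Icc a b, HasDerivAt φ (φ' s) s)
    (hφ' : ContinuousOn φ' (Icc a b)) (ha : φ a = 0) (hb : φ b = 0)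
    (hneg : ∫ s in a..b, (φ' s ^ 2 + (W s - E') * φ s ^ 2) < 0) :
    ∃ E : ℝ, -B - 1 ≤ E ∧ E ≤ E' ∧ ∃ v : ℝ → ℝ, IsSchrodingerSol (fun s => W s - E) v ∧
      v a = 1 ∧ deriv v a = 1 ∧ (∀ s ∈ Ico a b, 0 < v s) ∧ v b = 0 := by
  have hWE : ∀ E : ℝ, Continuous fun s => W s - E := fun E => hW.sub continuous_const
  -- the family of shooting solutions
  have hex : ∀ E : ℝ, ∃ v : ℝ → ℝ, IsSchrodingerSol (fun s => W s - E) v ∧ v a = 1 ∧ deriv v a = 1 :=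
    fun E => exists_isSchrodingerSol (hWE E) a 1 1
  choose v hv using hex
  have hsol : ∀ E, IsSchrodingerSol (fun s => W s - E) (v E) := fun E => (hv E).1
  have hva : ∀ E, v E a = 1 := fun E => (hv E).2.1
  have hva' : ∀ E, deriv (v E) a = 1 := fun E => (hv E).2.2
  -- positivity below `-B - 1`
  have hposE : ∀ E ≤ -B - 1, ∀ s ∈ Icc a b, 0 < v E s := fun E hE =>
    (hsol E).pos_of_nonneg_coeff (fun s _ => by linarith [hB s, neg_abs_le (W s)])
      (by rw [hva E]; exact zero_lt_one) (by rw [hva' E]; exact zero_le_one)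
  -- uniform continuity in `E` on `[a, b]`
  have hcontE : ∀ E₀ : ℝ, ∀ ε > 0, ∃ δ > 0, ∀ E, |E - E₀| < δ →
      ∀ s ∈ Icc a b, |v E s - v E₀ s| < ε := by
    intro E₀ ε hε
    obtain ⟨P, hP⟩ := isCompact_Icc.exists_bound_of_continuousOn
      ((hsol E₀).continuous.continuousOn (s := Icc a b))
    set P₁ : ℝ := |P| + 1 with hP₁
    have hP₁0 : 0 < P₁ := by positivity
    have hP' : ∀ s ∈ Icc a b, |v E₀ s| ≤ P₁ := fun s hs =>
      ((Real.norm_eq_abs _).symm.le.trans (hP s hs)).trans (by linarith [le_abs_self P])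
    set M : ℝ := Real.exp ((|B| + (|E₀| + 1) + 1) * |b - a|) with hM
    have hM0 : 0 < M := Real.exp_pos _
    refine ⟨min 1 (ε / (2 * P₁ * M)), lt_min zero_lt_one (by positivity), fun E hE s hs => ?_⟩
    have hE1 : |E - E₀| < 1 := lt_of_lt_of_le hE (min_le_left _ _)
    have hE2 : |E - E₀| < ε / (2 * P₁ * M) := lt_of_lt_of_le hE (min_le_right _ _)
    have hdist := (hsol E).dist_phase_le_param (hsol E₀) (left_mem_Icc.2 hab.le) (fun t _ => hB t)
      hP' hP₁0.le s hs
    rw [hva E, hva E₀, hva' E, hva' E₀, dist_self, zero_add] at hdist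
    have hexp : Real.exp ((|B| + |E| + 1) * |s - a|) ≤ M := by
      rw [hM, Real.exp_le_exp]
      have h1 : |E| ≤ |E₀| + 1 := by
        calc |E| = |(E - E₀) + E₀| := by ring_nf
          _ ≤ |E - E₀| + |E₀| := abs_add_le _ _
          _ ≤ |E₀| + 1 := by linarith
      have h2 : |s - a| ≤ |b - a| := by
        rw [abs_of_nonneg (by linarith [hs.1]), abs_of_nonneg (by linarith)]
        linarith [hs.2]
      have h3 : 0 ≤ |B| + |E| + 1 := by positivity
      calc (|B| + |E| + 1) * |s - a| ≤ (|B| + |E| + 1) * |b - a| :=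
            mul_le_mul_of_nonneg_left h2 h3
        _ ≤ (|B| + (|E₀| + 1) + 1) * |b - a| := by
            apply mul_le_mul_of_nonneg_right _ (abs_nonneg _); linarith
    calc |v E s - v E₀ s| ≤ dist (v E s, deriv (v E) s) (v E₀ s, deriv (v E₀) s) :=
          IsSchrodingerSol.abs_sub_le_dist_phase _ _ _
      _ ≤ |E - E₀| * P₁ * Real.exp ((|B| + |E| + 1) * |s - a|) := hdist
      _ ≤ |E - E₀| * P₁ * M := by gcongr
      _ < ε / (2 * P₁ * M) * P₁ * M := by gcongr
      _ = ε / 2 := by field_simp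
      _ < ε := by linarith
  -- the parameters `E ∈ [-B-1, E']` with a nonpositive value on `[a, b]`
  set Z : Set ℝ := {E | -B - 1 ≤ E ∧ E ≤ E' ∧ ∃ s ∈ Icc a b, v E s ≤ 0} with hZ
  have hE'Z : E' ∈ Z := by
    obtain ⟨s, hs, hvs⟩ := (hsol E').exists_nonpos_of_integral_neg (hWE E') hab.le hφ hφ' ha hb
      hneg
    refine ⟨?_, le_rfl, s, hs, hvs⟩
    by_contra h
    exact absurd hvs (not_le.2 (hposE E' (by linarith) s hs))
  have hZne : Z.Nonempty := ⟨E', hE'Z⟩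
  have hZbdd : BddBelow Z := ⟨-B - 1, fun E hE => hE.1⟩
  set E₀ := sInf Z with hE₀
  have hE₀le : E₀ ≤ E' := csInf_le hZbdd hE'Z
  have hE₀ge : -B - 1 ≤ E₀ := le_csInf hZne fun E hE => hE.1
  -- below `E₀` the shooting solutions are positive on `[a, b]`
  have hbelow : ∀ E < E₀, ∀ s ∈ Icc a b, 0 < v E s := by
    intro E hE s hs
    by_contra h
    push Not at h
    rcases le_or_gt E (-B - 1) with h1 | h1
    · exact absurd (hposE E h1 s hs) (not_lt.2 h)
    · have hEZ : E ∈ Z := ⟨h1.le, hE.le.trans hE₀le, s, hs, h⟩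
      exact absurd (csInf_le hZbdd hEZ) (not_le.2 hE)
  -- `E₀` itself has a nonpositive value (closedness)
  have hE₀Z : ∃ s ∈ Icc a b, v E₀ s ≤ 0 := by
    obtain ⟨Eseq, -, htend, hmem⟩ := exists_seq_tendsto_sInf hZne hZbdd
    obtain ⟨s₀, hs₀, hmin⟩ := isCompact_Icc.exists_isMinOn (nonempty_Icc.2 hab.le)
      ((hsol E₀).continuous.continuousOn (s := Icc a b))
    refine ⟨s₀, hs₀, le_of_forall_pos_lt_add fun ε hε => ?_⟩
    obtain ⟨δ, hδ, hcont⟩ := hcontE E₀ ε hε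
    obtain ⟨n, hn⟩ := ((Metric.tendsto_nhds.1 htend) δ hδ).exists
    obtain ⟨s, hs, hvs⟩ := (hmem n).2.2
    have h1 := hcont (Eseq n) (by rwa [← Real.dist_eq]) s hs
    have h2 : v E₀ s₀ ≤ v E₀ s := hmin hs
    rw [abs_lt] at h1
    linarith
  -- `v E₀ ≥ 0` on `[a, b]` (pointwise limit of positive solutions)
  have hnn : ∀ s ∈ Icc a b, 0 ≤ v E₀ s := by
    intro s hs
    refine le_of_forall_pos_lt_add fun ε hε => ?_
    obtain ⟨δ, hδ, hcont⟩ := hcontE E₀ ε hε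
    have h1 := hcont (E₀ - δ / 2) (by rw [abs_lt]; constructor <;> linarith) s hs
    have h2 := hbelow (E₀ - δ / 2) (by linarith) s hs
    rw [abs_lt] at h1
    linarith
  -- the zero of `v E₀` sits at `b`
  have hzero : ∀ z ∈ Ico a b, v E₀ z ≠ 0 := by
    intro z hz hvz
    rcases eq_or_lt_of_le hz.1 with h | h
    · rw [← h, hva E₀] at hvz
      exact one_ne_zero hvz
    · have := (hsol E₀).eq_zero_of_nonneg_Icc (hWE E₀) ⟨h, hz.2⟩ hnn hvz
      have h1 := hva E₀
      rw [this] at h1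
      exact one_ne_zero h1.symm
  obtain ⟨z, hz, hvz⟩ := hE₀Z
  have hvz0 : v E₀ z = 0 := le_antisymm hvz (hnn z hz)
  have hzb : z = b := by
    by_contra hne
    exact hzero z ⟨hz.1, lt_of_le_of_ne hz.2 hne⟩ hvz0
  refine ⟨E₀, hE₀ge, hE₀le, v E₀, hsol E₀, hva E₀, hva' E₀, fun s hs => ?_, hzb ▸ hvz0⟩
  exact (hnn s (Ico_subset_Icc_self hs)).lt_of_ne (Ne.symm (hzero s hs))

/-- **Shooting eigenpairs on all large intervals from a test function on the line.** Let `W` be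
continuous with `|W| ≤ B`, `ψ` of class `C¹` with `ψ², ψ'²` integrable and
`∫ (ψ'² + W ψ²) < E' ∫ ψ²`. Then there is `R₀ ≥ 1` such that for every `R ≥ R₀` there are
`E ∈ [-B - 1, E']` and a solution `v` of `v'' = (W - E) v` with `v (-R) = 1`, `v' (-R) = 1`,
`v > 0` on `[-R, R)` and `v R = 0` (truncation `exists_truncForm_integral_neg` + shooting
`exists_shooting_eigenpair`). [cite: Hartman2002, Ch. XI Thm. 6.2] -/
theorem exists_shooting_eigenpair_of_rayleigh {W : ℝ → ℝ} (hW : Continuous W) {B : ℝ}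
    (hB : ∀ s, |W s| ≤ B) {E' : ℝ} {ψ : ℝ → ℝ} (hψ : ContDiff ℝ 1 ψ)
    (hL2 : Integrable (fun s => ψ s ^ 2)) (hL2' : Integrable (fun s => deriv ψ s ^ 2))
    (hlt : ∫ s, (deriv ψ s ^ 2 + W s * ψ s ^ 2) < E' * ∫ s, ψ s ^ 2) :
    ∃ R₀ : ℝ, 1 ≤ R₀ ∧ ∀ R, R₀ ≤ R → ∃ E : ℝ, -B - 1 ≤ E ∧ E ≤ E' ∧
      ∃ v : ℝ → ℝ, IsSchrodingerSol (fun s => W s - E) v ∧ v (-R) = 1 ∧ deriv v (-R) = 1 ∧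
        (∀ s ∈ Ico (-R) R, 0 < v s) ∧ v R = 0 := by
  obtain ⟨R₀, hR₀, hR⟩ := exists_truncForm_integral_neg hW hB hψ hL2 hL2' hlt
  refine ⟨R₀, hR₀, fun R hRR => ?_⟩
  have hRpos : 0 < R := by linarith
  have hψd : Differentiable ℝ ψ := hψ.differentiable (by simp)
  refine exists_shooting_eigenpair hW hB (by linarith) (φ := truncFun ψ R) (φ' := truncDeriv ψ R)
    (fun s _ => hasDerivAt_truncFun hψd R s) (continuous_truncDeriv hψ R).continuousOn
    (truncFun_eq_zero (by rw [abs_neg, abs_of_pos hRpos]))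
    (truncFun_eq_zero (by rw [abs_of_pos hRpos])) ?_
  have h := hR R hRR
  unfold truncForm at h
  exact h

end Literature.Analysis.ODE
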